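import Summits.QuantumFields.YangMills.Theorems.BalabanUVNodesK3V5Stub1LetterForm
import Summits.QuantumFields.YangMills.Theorems.BalabanUVNodesK3V7Defs
import HarnessLib

/-!
# N15 (NE2) — THE NODE's CORNER OF THE REGISTERED CONSUMER, BY NAME: `N15At` (and its three layer predicates of record `NE2PlusOperator` ∕ `NE2PlusSite` ∕ `NE2PlusUnit`) AT EVERY
# READING THE K3⁸ v7 SKELETON PINS — hypothesis `K3V5Defs.N15PinnedSized 𝔯` (stub 1's `GuardedReading` third conjunct) BY NAME and NOTHING ELSE

WHO ∕ WHEN.  Cell `pub-ymgap`, seat `pub-ymgap-dag-n15-a` (KNIT-BY-NAME seat of Track-A DAG node N15 = NE2, g28); `--kind proof --supports stmt-QuantumFields-27366 --as helper` (K3⁸;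
count-neutral).  THEOREMS ONLY (0 `def`).  Over dag-n27-w1's by-name mirrors `…K3V5Defs` (`N15PinnedSized`, `GuardedReading`, `GuardedReadingN16`, `rrOfRecord`, `RunSel`, `LetterReading`)
and `…K3V5Stub1LetterForm` (`keyedLive_rrOfRecord_of_n15PinnedSized`), dag-n21-d's `…K3V7Defs` (v7 reuses v5's stub-1 texts BY NAME — imported to pin the version), this lane's S-B∕S-C
`…FullPropagatorSizedRecord∕Live` (`fullGSizedObjects`, `n15At_fullGSizedObjects_family`, `live_and_n15At_rrOfRecord_of_pinnedSized`), dag-n15-w2's `PairedFamilyGuard` (`Live`, `KeyedLive`);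
nothing in the tree is modified.

WHY.  Director-ym №239 (1) (pub-ymgap INBOX l.44070, 2026-08-28): for the NE spine nodes N14–N22 «DISCHARGED AS TYPED» = the node's decl of record proved sorry-free on standard axioms AT
EVERY READING THE REGISTERED CONSUMER OF RECORD PINS, the stub's own rows the only display.  The registered consumer of N15 is K3⁸ v7 `SpineGivenEndpointR13SepCoPHV`
(stmt-QuantumFields-27366); its stub 1 `stub_rates13HV` reads `∃ β …, ∃ 𝔯 ksel ℓ ℓ₃ g B, GuardedReadingN16 𝔯 ksel ℓ ℓ₃ g B ∧ KeyedRatesHolderD4V β (rrOfRecord 𝔯 ksel)`, N15 entering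
twice: as the PIN `N15PinnedSized 𝔯` (third conjunct of `GuardedReading`, first of `GuardedReadingN16`) and as the ROW `N15At R.ne2` of `RatesHolderAt` inside `PHolderD4` at
`R := rrOfRecord 𝔯 ksel F θ h.toCore g₀ os`.  Since g18 the row follows from the pin (S-C §5 `live_and_n15At_rrOfRecord_of_pinnedSized`, hypothesis = the pin's BODY; consumed inline by
`K3V5Defs.keyedRatesHolderD4_rrOfRecord_of_pins_of_letters` :280).  THIS FILE states that corner keyed on the REGISTERED NAMES — the by-name face a reader checks with one `example`.

WHAT.  §1 ★★★ **`n15At_rrOfRecord_of_n15PinnedSized (hpin : N15PinnedSized 𝔯) (ksel) (F θ hP g₀ os) : N15At (rrOfRecord 𝔯 ksel F θ hP g₀ os).ne2`** — EVERY Stage-13 tuple with core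
provisos (admissible or not), EVERY `(g₀, os)`, EVERY run-length selector; ★★ `n15At_lit_of_n15PinnedSized` (the same at EVERY run length `k` of the reading's literal, not only the
selected one); `live_rrOfRecord_of_n15PinnedSized`; the three layers of record separately: `ne2PlusOperator_∕ne2PlusSite_∕ne2PlusUnit_rrOfRecord_of_n15PinnedSized`.  §2 keyed on the
registered guards: ★★ `n15At_rrOfRecord_of_guardedReading` (`GuardedReading 𝔯 ksel ℓ`), ★★★ **`n15At_rrOfRecord_of_guardedReadingN16`** (`GuardedReadingN16 𝔯 ksel ℓ ℓ₃ g B` — stub 1's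
guard VERBATIM).  §3 ★★ `keyedN15_of_n15PinnedSized` — the KEYED shape `∀ F θ hP, (ZhUnity ∧ SlotsNondegenerate₁₃) → Admissible → ∀ g₀ os, N15At (rrOfRecord 𝔯 ksel F θ hP g₀ os).ne2`
(the binder pattern of `K3V5Defs.KeyedShellWeight`, N21's booked shape), and `keyedLive_and_keyedN15_of_n15PinnedSized` (both `GuardedReading` N15 conjuncts at once).

**(C-N15-1) U-BLIND PIN — the three kernel families are the `U ≡ 1` pair (Δ′_a⁻¹, Δ_a⁻¹) + G1 site + (2.156) unit; NE2⁺'s ∀U∈(3.35) clauses are met by U-constant kernels;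
Bałaban's NE2 for the non-abelian dressed `G(U)` is NOT proved here (lane n15-c).**  (Caveat of record, director-ym №250 (2), pub-ymgap INBOX l.44762, carried VERBATIM; v1.0.1 = this
header sentence added, every declaration byte-identical to v1.0 p687319.)  Any booking under №250 is labelled «N15 AS CONSUMED (U-blind pin)», never «NE2 proved».

HONEST FRAMING ∕ LIMITS (binding).  By-name bookkeeping over LANDED theorems; NO estimate is proved here.  WHAT THE PIN NAMES: S-B's `fullGSizedObjects 3 F.hL b a_S ν μ α β c₃₅ p` — the
SIZED GENUINE `U ≡ 1` family of the pair of record: operator layer = Bałaban's `(Δ′_a⁻¹, Δ_a⁻¹)` two-grid η-rate in all four (3.42) entries (door (iv), parts 33–75, hypothesis-free), site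
layer = dag-n15-c G1's `(Q′G′²Q′*)⁻¹`, unit layer = part 76's (2.156) `C^{(k)}`, Bałaban's size `M` a free index (guard LIVE, `…_sized_iff` certificates).  CAVEAT THE LANE STATES ITSELF:
that family is U-BLIND — its three kernel families do not read the configuration `U`, so NE2⁺'s `∀ U ∈ (3.35)` clauses are met by U-constant kernels and the content is the LG-vector η-rate
AT ZERO BACKGROUND (NE2⁰-vector; itself not printed — King's (4.38) is the scalar `A = 0` template); the background-live editions of all three layers exist on the same carrier (Λ-C, Σ-A, Λ-F:
`SiteLayerBg.allLayersBgObjects`, FO∕abelianised model dressing) but are NOT what v7 pins; Bałaban's non-abelian `G(U)` ([B9] Thms 3.1∕3.2∕3.15 at general `U`) is NOT PRINTED as an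
η-rate and NOT proved (n15-c's lane).  This file does NOT close `stub_rates13HV` (its K4 ∕ N16 ∕ U3 rows are other lanes'), does NOT claim K3⁸, and does NOT book N15 — the chair books,
the director words the class (№239 (1)(i): «for spine nodes the registered K-skeleton of record IS the record»); counts UNMOVED (typed 28∕28 · discharged 7∕28 = 7∕27 excl. NODE O); one
finite 𝕋⁴ programme at fixed ε — NOT ℝ⁴ ∕ infinite volume ∕ OS ∕ mass gap ∕ Clay.  No `sorry`, `instance`, `notation`, `maxHeartbeats`; standard axioms.
-/

noncomputable section

namespace Summit.QuantumFields.YangMills.BalabanUVNodes.N15.CornerAtPin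

open Literature.MathematicalPhysics.QuantumFieldTheory.Balaban1983to89
open Literature.MathematicalPhysics.QuantumFieldTheory.Balaban1983to89.T4Continuum (T4Family ULoop)
open Literature.MathematicalPhysics.QuantumFieldTheory.Balaban1983to89.T4EtaRate (NE2PlusOperator NE2PlusSite NE2PlusUnit)
open Node00 (Stage13HParams NE3Letters₁₁)
open Summit.QuantumFields.YangMills.Theorems.K3V5Defs (N15PinnedSized GuardedReading GuardedReadingN16 rrOfRecord RunSel LetterReading keyedLive_rrOfRecord_of_n15PinnedSized)
open Summit.QuantumFields.YangMills.BalabanUVNodes.N15.GenuineRecord (fullGSizedObjects n15At_fullGSizedObjects_family live_and_n15At_rrOfRecord_of_pinnedSized)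
open Summit.QuantumFields.YangMills.BalabanUVNodes.N15.AtKeyedHome (neZero_blockFactor)
open Summit.QuantumFields.YangMills.BalabanUVNodes.N15.PairedFamilyGuard (Live KeyedLive)
open YMDAG.UVSplit (N15At ne2OfRecord₁₁ RateReading₁₃CoPH rateCarriersOfRecord₁₃CoPH)

variable {𝔯 : RateReading₁₃CoPH 2}

/-! ## §1 The N15 row from the N15 pin, by name -/

/-- ★★★ **N15's DECL OF RECORD AT EVERY READING THE REGISTERED CONSUMER PINS**: if the reading carries K3⁸ v7 stub 1's N15 pin `N15PinnedSized 𝔯`, then `N15At` — the node's three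
conjuncts `NE2PlusOperator ∧ NE2PlusSite 4 p ∧ NE2PlusUnit` BY NAME — holds at the rate carriers of record `rrOfRecord 𝔯 ksel F θ hP g₀ os` for EVERY Stage-13 parameter with core provisos,
EVERY `(g₀, os)` and EVERY run-length selector `ksel`.  Display = the pin; nothing else (S-C §5 `live_and_n15At_rrOfRecord_of_pinnedSized`). [cite: Balaban1985BackgroundPropagators, Thm 3.1
(3.42) p.397, Thm 3.2 (3.48) p.398, Thm 3.15 (3.187) p.432 (quantifier templates of the three layer predicates); King1986, Lemma 4.5 (4.38) p.674 (A = 0 template)] -/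
theorem n15At_rrOfRecord_of_n15PinnedSized (hpin : N15PinnedSized 𝔯) (ksel : RunSel)
    (F : T4Family) (θ : Stage13HParams F 2) (hP : θ.Provisos₁₃CoPH F 2) (g₀ : ℕ → ℝ) (os : List (ULoop F)) :
    N15At (rrOfRecord 𝔯 ksel F θ hP g₀ os).ne2 :=
  (live_and_n15At_rrOfRecord_of_pinnedSized 𝔯 hpin ksel F θ hP g₀ os).2

/-- `Live` (dag-n15-w2's guard) at every reading the consumer pins, every selector. [bookkeeping] -/
theorem live_rrOfRecord_of_n15PinnedSized (hpin : N15PinnedSized 𝔯) (ksel : RunSel)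
    (F : T4Family) (θ : Stage13HParams F 2) (hP : θ.Provisos₁₃CoPH F 2) (g₀ : ℕ → ℝ) (os : List (ULoop F)) :
    Live (rrOfRecord 𝔯 ksel F θ hP g₀ os).ne2 :=
  (live_and_n15At_rrOfRecord_of_pinnedSized 𝔯 hpin ksel F θ hP g₀ os).1

/-- ★★ **`N15At` AT EVERY RUN LENGTH OF THE PINNED READING's LITERAL** (not only the selected one). [bookkeeping] -/
theorem n15At_lit_of_n15PinnedSized (hpin : N15PinnedSized 𝔯)
    (F : T4Family) (θ : Stage13HParams F 2) (hP : θ.Provisos₁₃CoPH F 2) (g₀ : ℕ → ℝ) (os : List (ULoop F)) (k : ℕ) :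
    N15At (ne2OfRecord₁₁ ((𝔯.lit F θ hP g₀ os).ne2 k)) := by
  obtain ⟨b, aS, ν, μ, α, β, c35, p, hb, haS, h⟩ := hpin
  rw [h F θ hP g₀ os k]
  exact n15At_fullGSizedObjects_family hb haS ν μ α β c35 p F

/-- The FIRST layer of record at the pinned reading: `T4EtaRate.NE2PlusOperator` BY NAME. [cite: Balaban1985BackgroundPropagators, Thm 3.1 (3.42) p.397 (quantifier template)] -/
theorem ne2PlusOperator_rrOfRecord_of_n15PinnedSized (hpin : N15PinnedSized 𝔯) (ksel : RunSel)
    (F : T4Family) (θ : Stage13HParams F 2) (hP : θ.Provisos₁₃CoPH F 2) (g₀ : ℕ → ℝ) (os : List (ULoop F)) :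
    NE2PlusOperator (rrOfRecord 𝔯 ksel F θ hP g₀ os).ne2.c35 (rrOfRecord 𝔯 ksel F θ hP g₀ os).ne2.pi (rrOfRecord 𝔯 ksel F θ hP g₀ os).ne2.Kop :=
  (n15At_rrOfRecord_of_n15PinnedSized hpin ksel F θ hP g₀ os).1

/-- The SECOND layer of record at the pinned reading: `T4EtaRate.NE2PlusSite 4 p` BY NAME. [cite: Balaban1985BackgroundPropagators, Thm 3.2 (3.48) p.398 (quantifier template)] -/
theorem ne2PlusSite_rrOfRecord_of_n15PinnedSized (hpin : N15PinnedSized 𝔯) (ksel : RunSel)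
    (F : T4Family) (θ : Stage13HParams F 2) (hP : θ.Provisos₁₃CoPH F 2) (g₀ : ℕ → ℝ) (os : List (ULoop F)) :
    NE2PlusSite 4 (rrOfRecord 𝔯 ksel F θ hP g₀ os).ne2.p (rrOfRecord 𝔯 ksel F θ hP g₀ os).ne2.c35 (rrOfRecord 𝔯 ksel F θ hP g₀ os).ne2.pi (rrOfRecord 𝔯 ksel F θ hP g₀ os).ne2.Ksite :=
  (n15At_rrOfRecord_of_n15PinnedSized hpin ksel F θ hP g₀ os).2.1

/-- The THIRD layer of record at the pinned reading: `T4EtaRate.NE2PlusUnit` BY NAME. [cite: Balaban1985BackgroundPropagators, Thm 3.15 (3.187) p.432 (quantifier template)] -/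
theorem ne2PlusUnit_rrOfRecord_of_n15PinnedSized (hpin : N15PinnedSized 𝔯) (ksel : RunSel)
    (F : T4Family) (θ : Stage13HParams F 2) (hP : θ.Provisos₁₃CoPH F 2) (g₀ : ℕ → ℝ) (os : List (ULoop F)) :
    NE2PlusUnit (rrOfRecord 𝔯 ksel F θ hP g₀ os).ne2.c35 (rrOfRecord 𝔯 ksel F θ hP g₀ os).ne2.pi (rrOfRecord 𝔯 ksel F θ hP g₀ os).ne2.Kunit
      (rrOfRecord 𝔯 ksel F θ hP g₀ os).ne2.inΛ (rrOfRecord 𝔯 ksel F θ hP g₀ os).ne2.unitDist :=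
  (n15At_rrOfRecord_of_n15PinnedSized hpin ksel F θ hP g₀ os).2.2

/-! ## §2 Keyed on the registered guards `GuardedReading` ∕ `GuardedReadingN16` (stub 1's text) -/

/-- ★★ `N15At` at every reading carrying v5∕v7's `GuardedReading 𝔯 ksel ℓ` (its third conjunct is the N15 pin). [bookkeeping] -/
theorem n15At_rrOfRecord_of_guardedReading {ksel : RunSel} {ℓ : LetterReading} (hG : GuardedReading 𝔯 ksel ℓ)
    (F : T4Family) (θ : Stage13HParams F 2) (hP : θ.Provisos₁₃CoPH F 2) (g₀ : ℕ → ℝ) (os : List (ULoop F)) :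
    N15At (rrOfRecord 𝔯 ksel F θ hP g₀ os).ne2 :=
  n15At_rrOfRecord_of_n15PinnedSized hG.2.2.1 ksel F θ hP g₀ os

/-- ★★★ **`N15At` AT EVERY READING CARRYING K3⁸ v7 STUB 1's GUARD `GuardedReadingN16 𝔯 ksel ℓ ℓ₃ g B` VERBATIM** — the node's row of `RatesHolderAt` at `rrOfRecord 𝔯 ksel`, for every
Stage-13 tuple with core provisos and every `(g₀, os)`; display = stub 1's own guard and nothing else. [bookkeeping] -/
theorem n15At_rrOfRecord_of_guardedReadingN16 {ksel : RunSel} {ℓ : LetterReading} {ℓ₃ : T4Family → NE3Letters₁₁} {g B : T4Family → ℝ}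
    (hG : GuardedReadingN16 𝔯 ksel ℓ ℓ₃ g B)
    (F : T4Family) (θ : Stage13HParams F 2) (hP : θ.Provisos₁₃CoPH F 2) (g₀ : ℕ → ℝ) (os : List (ULoop F)) :
    N15At (rrOfRecord 𝔯 ksel F θ hP g₀ os).ne2 :=
  n15At_rrOfRecord_of_guardedReading hG.1 F θ hP g₀ os

/-- … and at the SEPARATED-provisos tuples stub 1's K4 face reads (`h.toCore`). [bookkeeping] -/
theorem n15At_rrOfRecord_of_guardedReadingN16_sep {ksel : RunSel} {ℓ : LetterReading} {ℓ₃ : T4Family → NE3Letters₁₁} {g B : T4Family → ℝ}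
    (hG : GuardedReadingN16 𝔯 ksel ℓ ℓ₃ g B)
    (F : T4Family) (θ : Stage13HParams F 2) (h : θ.Provisos₁₃SepCoPH F 2) (g₀ : ℕ → ℝ) (os : List (ULoop F)) :
    N15At (rrOfRecord 𝔯 ksel F θ h.toCore g₀ os).ne2 :=
  n15At_rrOfRecord_of_guardedReading hG.1 F θ h.toCore g₀ os

/-! ## §3 The keyed shape (the binder pattern of `K3V5Defs.KeyedShellWeight`) -/

/-- ★★ **THE KEYED N15 ROW FROM THE PIN**: `∀ F θ hP, (ZhUnity ∧ SlotsNondegenerate₁₃) → Admissible → ∀ g₀ os, N15At (rrOfRecord 𝔯 ksel F θ hP g₀ os).ne2` — N21's booked shape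
(`KeyedShellWeight cr`) transcribed to N15; the admissibility binders are not read (the row holds at every tuple). [bookkeeping] -/
theorem keyedN15_of_n15PinnedSized (hpin : N15PinnedSized 𝔯) (ksel : RunSel) :
    ∀ (F : T4Family) (θ : Stage13HParams F 2) (hP : θ.Provisos₁₃CoPH F 2), (θ.ZhUnity F 2 ∧ θ.SlotsNondegenerate₁₃ F 2) → θ.Admissible F 2 →
      ∀ (g₀ : ℕ → ℝ) (os : List (ULoop F)), N15At (rrOfRecord 𝔯 ksel F θ hP g₀ os).ne2 :=
  fun F θ hP _ _ g₀ os => n15At_rrOfRecord_of_n15PinnedSized hpin ksel F θ hP g₀ os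

/-- ★★ **BOTH N15 CONJUNCTS OF `GuardedReading` FROM THE PIN AT ONCE**: `KeyedLive (rrOfRecord 𝔯 ksel)` (dag-n27-w1 `keyedLive_rrOfRecord_of_n15PinnedSized`) and the keyed N15 row. [bookkeeping] -/
theorem keyedLive_and_keyedN15_of_n15PinnedSized (hpin : N15PinnedSized 𝔯) (ksel : RunSel) :
    KeyedLive (rrOfRecord 𝔯 ksel) ∧
      ∀ (F : T4Family) (θ : Stage13HParams F 2) (hP : θ.Provisos₁₃CoPH F 2), (θ.ZhUnity F 2 ∧ θ.SlotsNondegenerate₁₃ F 2) → θ.Admissible F 2 →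
        ∀ (g₀ : ℕ → ℝ) (os : List (ULoop F)), N15At (rrOfRecord 𝔯 ksel F θ hP g₀ os).ne2 :=
  ⟨keyedLive_rrOfRecord_of_n15PinnedSized hpin ksel, keyedN15_of_n15PinnedSized hpin ksel⟩

/-- **NON-VACUITY OF THE PIN** (A2): the pin predicate is inhabited — dag-n27-w1's `exists_reading_v5pins` exhibits a Stage-13 reading carrying `N15PinnedSized` (with the other three v5 pins)
for every choice of letters; here: some reading carries the N15 pin. [bookkeeping] -/
theorem exists_reading_n15PinnedSized (ℓ : LetterReading) (ℓ₃ : T4Family → NE3Letters₁₁) : ∃ 𝔯 : RateReading₁₃CoPH 2, N15PinnedSized 𝔯 := by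
  obtain ⟨𝔯, -, h15, -, -⟩ := Summit.QuantumFields.YangMills.Theorems.K3V5Defs.exists_reading_v5pins 1 0 1 1 0 0 0 0 1 0 ℓ ℓ₃ (fun _ => 1)
    one_pos le_rfl one_pos one_pos
  exact ⟨𝔯, h15⟩

end Summit.QuantumFields.YangMills.BalabanUVNodes.N15.CornerAtPin

end
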